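import Summits.Ventures.Crystal3D.Theorems.StickyWulffConstantPolycrystalWulffBoundArrangementCells

/-!
# `PolycrystalWulffBound`, rung `rung_basalLamellar` — step 2e: adjacent cells of an arrangement
# (generic real inner product space; line `PolyDensity`, crux `stmt-Ventures-19482`)

Route `StickyWulffConstant` of the venture `Summits/Ventures/Crystal3D`, second prover lane (poly-p2,
gen 3).  Sign-vector cells of the arrangement of a finite unit-normal constraint set `𝓗` (as in
`…ArrangementCells`; `𝓗` may contain a plane twice, as `p` and `(−p.1, −p.2)`).  Two ingredients of the
ARRANGEMENT PACKAGE consumed by `volume_chimera_le_of_package`: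
* `closure_arrCell_inter_plane_subset_closure` — if the sign vectors `T, T'` agree at every
  constraint off the plane of `p` and differ at `p`, and the cell of `T` is nonempty, then
  `closure (cell T') ∩ {⟪p.1, x⟫ = p.2} ⊆ closure (cell T)` (segment towards a point of the cell of
  `T`): the common facet of ADJACENT cells is the full face of either on the separating plane;
* `chimera_point_trichotomy_planes` — the trichotomy of `…MinkowskiCovering` with the third case
  sharpened to two DIFFERENT PLANES (not merely two different constraints) and the second case
  phrased as «the sign vectors agree off the plane of `p`».
WHAT THIS IS NOT: any measure theory; nothing on the crux.
-/

noncomputable section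

open scoped BigOperators InnerProductSpace Classical Topology
open Set Filter

namespace Summit.Ventures.Crystal3D.Theorems

variable {E : Type*} [NormedAddCommGroup E] [InnerProductSpace ℝ E]

/-- On a common plane, two unit-normal constraints coincide up to sign, so a point of the plane
satisfies both with equality. -/
theorem inner_eq_of_plane_eq {p p' : E × ℝ}
    (hpl : {x : E | ⟪p'.1, x⟫_ℝ = p'.2} = {x : E | ⟪p.1, x⟫_ℝ = p.2}) {y : E}
    (hy : ⟪p.1, y⟫_ℝ = p.2) : ⟪p'.1, y⟫_ℝ = p'.2 := by
  have : y ∈ {x : E | ⟪p'.1, x⟫_ℝ = p'.2} := by rw [hpl]; exact hy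
  exact this

/-- **Adjacent cells share the full face.**  Let the cell of `T` be nonempty and suppose `T` and
`T'` agree at every constraint of `𝓗` off the plane of `p`.  Then
`closure (cell T') ∩ {⟪p.1, x⟫ = p.2} ⊆ closure (cell T)`. -/
theorem closure_arrCell_inter_plane_subset_closure (𝓗 T T' : Finset (E × ℝ)) {p : E × ℝ}
    (hagree : ∀ q ∈ 𝓗, (q ∈ T ↔ q ∈ T') ∨ {x : E | ⟪q.1, x⟫_ℝ = q.2} = {x : E | ⟪p.1, x⟫_ℝ = p.2})
    (hne : (⋂ q ∈ 𝓗.image (fun p : E × ℝ => if p ∈ T then p else (-p.1, -p.2)),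
      {y : E | ⟪q.1, y⟫_ℝ < q.2}).Nonempty) :
    closure (⋂ q ∈ 𝓗.image (fun p : E × ℝ => if p ∈ T' then p else (-p.1, -p.2)),
        {y : E | ⟪q.1, y⟫_ℝ < q.2}) ∩ {x : E | ⟪p.1, x⟫_ℝ = p.2} ⊆
      closure (⋂ q ∈ 𝓗.image (fun p : E × ℝ => if p ∈ T then p else (-p.1, -p.2)),
        {y : E | ⟪q.1, y⟫_ℝ < q.2}) := by
  rintro y ⟨hyT', hyp⟩
  obtain ⟨z₀, hz₀⟩ := hne
  rw [mem_arrCell_iff] at hz₀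
  have hycl := closure_arrCell_subset 𝓗 T' hyT'
  -- the segment from `y` towards `z₀` lies in the cell of `T` for positive parameters
  have hseg : ∀ s : ℝ, 0 < s → s ≤ 1 → y + s • (z₀ - y) ∈
      ⋂ q ∈ 𝓗.image (fun p : E × ℝ => if p ∈ T then p else (-p.1, -p.2)), {y : E | ⟪q.1, y⟫_ℝ < q.2} := by
    intro s hs hs1
    rw [mem_arrCell_iff]
    intro q hq
    have hlin : ⟪q.1, y + s • (z₀ - y)⟫_ℝ = (1 - s) * ⟪q.1, y⟫_ℝ + s * ⟪q.1, z₀⟫_ℝ := by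
      rw [inner_add_right, real_inner_smul_right, inner_sub_right]; ring
    obtain ⟨hz1, hz2⟩ := hz₀ q hq
    rcases hagree q hq with hqq | hpl
    · obtain ⟨hy1, hy2⟩ := hycl q hq
      refine ⟨fun hqT => ?_, fun hqT => ?_⟩
      · have a := hy1 (hqq.1 hqT); have b := hz1 hqT
        rw [hlin]; nlinarith
      · have a := hy2 (fun h => hqT (hqq.2 h)); have b := hz2 hqT
        rw [hlin]; nlinarith
    · have hyq : ⟪q.1, y⟫_ℝ = q.2 := inner_eq_of_plane_eq hpl hyp
      refine ⟨fun hqT => ?_, fun hqT => ?_⟩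
      · have b := hz1 hqT
        rw [hlin, hyq]; nlinarith
      · have b := hz2 hqT
        rw [hlin, hyq]; nlinarith
  -- and tends to `y`
  have htend : Tendsto (fun s : ℝ => y + s • (z₀ - y)) (𝓝[>] 0) (𝓝 y) := by
    have hc : Continuous fun s : ℝ => y + s • (z₀ - y) := by fun_prop
    have h := hc.tendsto 0
    rw [zero_smul, add_zero] at h
    exact h.mono_left nhdsWithin_le_nhds
  refine mem_closure_of_tendsto htend ?_
  have hev : ∀ᶠ s in 𝓝[>] (0 : ℝ), s < 1 := nhdsWithin_le_nhds (eventually_lt_nhds zero_lt_one)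
  filter_upwards [hev, self_mem_nhdsWithin] with s hs1 hs0
  exact hseg s hs0 hs1.le

/-- **Trichotomy, plane form.**  As `chimera_point_trichotomy`, with the third alternative giving two
constraints with DIFFERENT planes and the second alternative saying that the sign vector of `x`
agrees with `T` off the plane of `p` and differs at `p`. -/
theorem chimera_point_trichotomy_planes (𝓗 T : Finset (E × ℝ))
    (h1 : ∀ p ∈ 𝓗, ‖p.1‖ = 1) (hT : T ⊆ 𝓗)
    {q x k : E} {K : Set E} {R r : ℝ}
    (hq : ∀ p ∈ 𝓗, (p ∈ T → ⟪p.1, q⟫_ℝ < p.2) ∧ (p ∉ T → p.2 < ⟪p.1, q⟫_ℝ))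
    (hK : K ⊆ Metric.closedBall 0 R) (hk : k ∈ K) (hr : 0 < r) (hx : x = q + r • k)
    (hoff : ∀ p ∈ 𝓗, ⟪p.1, x⟫_ℝ ≠ p.2) :
    𝓗.filter (fun p => ⟪p.1, x⟫_ℝ < p.2) = T ∨
      (∃ p ∈ 𝓗, ¬ (p ∈ T ↔ p ∈ 𝓗.filter (fun p => ⟪p.1, x⟫_ℝ < p.2)) ∧
        (∀ p' ∈ 𝓗, (p' ∈ T ↔ p' ∈ 𝓗.filter (fun p => ⟪p.1, x⟫_ℝ < p.2)) ∨
          {y : E | ⟪p'.1, y⟫_ℝ = p'.2} = {y : E | ⟪p.1, y⟫_ℝ = p.2}) ∧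
        ((p ∈ T ∧ p.2 < ⟪p.1, x⟫_ℝ ∧ ⟪p.1, x⟫_ℝ < p.2 + r * sSup ((fun y => ⟪y, p.1⟫_ℝ) '' K)) ∨
         (p ∉ T ∧ -p.2 < ⟪-p.1, x⟫_ℝ ∧ ⟪-p.1, x⟫_ℝ < -p.2 + r * sSup ((fun y => ⟪y, -p.1⟫_ℝ) '' K)))) ∨
      (∃ p ∈ 𝓗, ∃ p' ∈ 𝓗, {y : E | ⟪p.1, y⟫_ℝ = p.2} ≠ {y : E | ⟪p'.1, y⟫_ℝ = p'.2} ∧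
        |⟪p.1, x⟫_ℝ - p.2| ≤ r * R ∧ |⟪p'.1, x⟫_ℝ - p'.2| ≤ r * R) := by
  -- norms and the body
  have hkR : ‖k‖ ≤ R := mem_closedBall_zero_iff.1 (hK hk)
  have hKbdd : ∀ v : E, BddAbove ((fun y => ⟪y, v⟫_ℝ) '' K) := by
    intro v
    refine ⟨R * ‖v‖, ?_⟩
    rintro _ ⟨y, hy, rfl⟩
    calc ⟪y, v⟫_ℝ ≤ ‖y‖ * ‖v‖ := real_inner_le_norm _ _
      _ ≤ R * ‖v‖ := by gcongr; exact mem_closedBall_zero_iff.1 (hK hy)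
  have hksup : ∀ v : E, ⟪k, v⟫_ℝ ≤ sSup ((fun y => ⟪y, v⟫_ℝ) '' K) :=
    fun v => le_csSup (hKbdd v) ⟨k, hk, rfl⟩
  -- differing constraints
  set D : Finset (E × ℝ) := 𝓗.filter (fun p => ¬ (p ∈ T ↔ ⟪p.1, x⟫_ℝ < p.2)) with hD
  have hsign : ∀ p ∈ 𝓗, (p ∈ 𝓗.filter (fun p => ⟪p.1, x⟫_ℝ < p.2) ↔ (p ∈ T ↔ p ∉ D)) := by
    intro p hp
    simp only [hD, Finset.mem_filter, hp, true_and]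
    tauto
  have hxq : ∀ v : E, ⟪v, x⟫_ℝ = ⟪v, q⟫_ℝ + r * ⟪v, k⟫_ℝ := by
    intro v; rw [hx, inner_add_right, real_inner_smul_right]
  have hpk : ∀ p ∈ 𝓗, |⟪p.1, k⟫_ℝ| ≤ R := fun p hp =>
    (abs_real_inner_le_norm _ _).trans (by rw [h1 p hp, one_mul]; exact hkR)
  have hnear : ∀ p ∈ D, |⟪p.1, x⟫_ℝ - p.2| ≤ r * R := by
    intro p hpD
    obtain ⟨hp, hdiff⟩ := Finset.mem_filter.1 hpD
    obtain ⟨hqT, hqT'⟩ := hq p hp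
    have hne := hoff p hp
    have hk1 := abs_le.1 (hpk p hp)
    have e := hxq p.1
    by_cases hpT : p ∈ T
    · have hq1 : ⟪p.1, q⟫_ℝ < p.2 := hqT hpT
      have hx1 : ¬ ⟪p.1, x⟫_ℝ < p.2 := fun h => hdiff ⟨fun _ => h, fun _ => hpT⟩
      rw [abs_le]; constructor <;> nlinarith [not_lt.1 hx1, hk1.1, hk1.2, hr]
    · have hq1 : p.2 < ⟪p.1, q⟫_ℝ := hqT' hpT
      have hx1 : ⟪p.1, x⟫_ℝ < p.2 := by
        by_contra h
        exact hdiff ⟨fun h' => absurd h' hpT, fun h' => absurd h' h⟩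
      rw [abs_le]; constructor <;> nlinarith [hk1.1, hk1.2, hr]
  by_cases hD0 : D = ∅
  · left
    ext p
    constructor
    · intro hp
      have hp𝓗 : p ∈ 𝓗 := (Finset.mem_filter.1 hp).1
      have := (hsign p hp𝓗).1 hp
      rw [hD0] at this
      simpa using this
    · intro hpT
      have hp𝓗 : p ∈ 𝓗 := hT hpT
      refine (hsign p hp𝓗).2 ?_
      rw [hD0]; simpa using hpT
  · obtain ⟨p, hpD⟩ := Finset.nonempty_iff_ne_empty.2 hD0
    have hp𝓗 : p ∈ 𝓗 := (Finset.mem_filter.1 hpD).1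
    by_cases hD1 : ∀ p' ∈ D, {y : E | ⟪p'.1, y⟫_ℝ = p'.2} = {y : E | ⟪p.1, y⟫_ℝ = p.2}
    · -- all differing constraints lie on the plane of `p`: adjacent across that plane
      right; left
      refine ⟨p, hp𝓗, ?_, ?_, ?_⟩
      · have hs := hsign p hp𝓗
        intro h
        have : p ∉ D := by
          rw [hs] at h
          by_contra hpD'
          exact absurd hpD' (by tauto)
        exact this hpD
      · intro p' hp'
        by_cases hp'D : p' ∈ D
        · exact Or.inr (hD1 p' hp'D)
        · left
          have hs := hsign p' hp'
          rw [hs]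
          tauto
      · obtain ⟨-, hdiff⟩ := Finset.mem_filter.1 hpD
        have hne := hoff p hp𝓗
        obtain ⟨hqT, hqT'⟩ := hq p hp𝓗
        by_cases hpT : p ∈ T
        · left
          have hx1 : ¬ ⟪p.1, x⟫_ℝ < p.2 := fun h => hdiff ⟨fun _ => h, fun _ => hpT⟩
          have hq1 : ⟪p.1, q⟫_ℝ < p.2 := hqT hpT
          have hk1 : ⟪p.1, k⟫_ℝ ≤ sSup ((fun y => ⟪y, p.1⟫_ℝ) '' K) := by
            rw [real_inner_comm]; exact hksup p.1
          refine ⟨hpT, lt_of_le_of_ne (not_lt.1 hx1) (Ne.symm hne), ?_⟩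
          rw [hxq]; nlinarith
        · right
          have hx1 : ⟪p.1, x⟫_ℝ < p.2 := by
            by_contra h
            exact hdiff ⟨fun h' => absurd h' hpT, fun h' => absurd h' h⟩
          have hq1 : ⟪-p.1, q⟫_ℝ < -p.2 := by rw [inner_neg_left]; linarith [hqT' hpT]
          have hk1 : ⟪-p.1, k⟫_ℝ ≤ sSup ((fun y => ⟪y, -p.1⟫_ℝ) '' K) := by
            rw [real_inner_comm]; exact hksup (-p.1)
          refine ⟨hpT, by rw [inner_neg_left]; linarith, ?_⟩
          rw [hxq]; nlinarith
    · -- two differing constraints on different planes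
      right; right
      push Not at hD1
      obtain ⟨p', hp'D, hp'p⟩ := hD1
      exact ⟨p', (Finset.mem_filter.1 hp'D).1, p, hp𝓗, hp'p, hnear p' hp'D, hnear p hpD⟩

end Summit.Ventures.Crystal3D.Theorems

end
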